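import Summits.CriticalPhenomena.PercolationContinuityZ3.Theorems.PercNearOneGluingNoHeavyLowerTailFloorSplitOneLayerRows
import HarnessLib

/-!
# `NoHeavyLowerTail` (stmt-CriticalPhenomena-4575) — the STAR RECURSION for the pre-FKG cumulative isolation
# inequality (general observers, fixed witness)

Lemma factory #5 (`prim-lf-5`, gen 14; memo `run/shared/lean/prim/prim-lf-5/STAR-RECURSION.md`).
`--supports stmt-CriticalPhenomena-4575`.  No definitions, no named facts, no sorries.

Bond percolation `μ = prodBernoulli w` on a finite vertex type, relays `A`, an ARBITRARY observer `o ∉ A` (its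
positive-weight neighbours may be relays or Steiner vertices), a level `j`, `N = |{x ∈ A : o ↔ x}|`,
`N_v = |{x ∈ A : v ↔ x}|`, the bad event `{1 ≤ N ≤ j}`, and the joint lightness `S_c = μ(o ↔ A, N_c ≤ j)`.
The **pre-FKG cumulative isolation inequality** (pre-CIL) with witness `c ∈ A` is `μ(1 ≤ N ≤ j) ≤ S_c`; it implies the
cumulative isolation lemma `μ(1 ≤ N ≤ j) ≤ μ(N_c ≤ j)` (hypothesis of `noHeavyLowerTail_of_stub_cumulativeIsolation`) and
is Kozma–Nitzan's Conjecture 4 (arXiv:2401.12397, §5.1) for the monotone cluster property `|C ∩ A| > j`.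

Decompose along Kozma–Nitzan's stars `σ_B` (the open pairs at `o` are exactly those to `B`, `B ⊆ V ∖ {o}`): under
`σ_B` every cluster is read off `H = G ∖ {o}` (`FloorSplitOneLayer.reachable_iff_of_starEvent`, port-type blind),
the relays joined to `o` are `U(B) = {x ∈ A : B ↔ x off o}`, and the relays joined to `c` are `U(B)` if `c ↔ B`
off `o`, else `c`'s `H`-pocket.  Hence (`μ(E) = Σ_B μ(E ∩ σ_B)`):

* `relayStar_bad_le` — **a star containing a relay `b` that is `H`-heavier than `c`** satisfies the pre-CIL
  inequality ON THE STAR: `μ(σ_B ∩ {1 ≤ N ≤ j}) ≤ μ(σ_B ∩ {o ↔ A, N_c ≤ j})`.  After factoring the independent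
  star weight this is `P_H(U(B) small, c ↮ B) ≤ P_H(c small, c ↮ B)`, Kozma–Nitzan's Lemma 5 for the property
  `|C ∩ A| > j` (`FloorSplitOneLayer.starRow_transfer` with `v = c`, i.e. Lemma 3(ii) in cluster form).
* `preCIL_of_starRows` — **the star recursion**: if `c` is `H`-lighter than every positive-weight RELAY neighbour
  of `o`, and the pre-CIL inequality holds on every positive-weight star made of NON-relays (these are exactly the
  pre-CIL inequalities of the smaller instances "`B` glued into one observer in `H`"), then pre-CIL holds for
  `(G, o)` with witness `c`.  This is Kozma–Nitzan's Theorem 5 (one Steiner neighbour `x`) for ANY number of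
  Steiner neighbours and for the pocket-size property; the one-layer case (no Steiner star of positive weight) is
  `preCIL_oneLayer_Hwitness`, and `cumulativeIsolation_of_starRows` records the CIL form.
-/

noncomputable section

namespace Summit.CriticalPhenomena.PercolationContinuityZ3.Theorems

open MeasureTheory Set Literature.Probability.LatticeModels Literature.Probability.Percolation
open Literature.Probability.Percolation.KNPreFKG
open scoped Classical

namespace PreCILStar

variable {V : Type*} [Fintype V]

open FloorSplitOneLayer

omit [Fintype V] in
/-- A star through a weight-`0` pair is null: if `w s(o,u) = 0` for some `u ∈ B` then `μ(σ_B) = 0`. [folklore] -/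
theorem real_starEvent_eq_zero_of_weight (w : Sym2 V → unitInterval) {o : V} {B : Finset V} {u : V}
    (huB : u ∈ B) (huo : u ≠ o) (hw : w s(o, u) = 0) :
    (prodBernoulli w).real (starEvent o (↑B : Set V)) = 0 := by
  refine le_antisymm ?_ measureReal_nonneg
  have hsub : starEvent o (↑B : Set V) ⊆ {ω : BondConfig V | s(o, u) ∈ ω} := fun ω hω =>
    ((mem_starEvent_iff o (↑B) ω).1 hω u huo).2 huB
  calc (prodBernoulli w).real (starEvent o (↑B : Set V))
      ≤ (prodBernoulli w).real {ω : BondConfig V | s(o, u) ∈ ω} := measureReal_mono hsub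
    _ = 0 := by rw [prodBernoulli_real_setOf_mem, hw]; rfl

omit [Fintype V] in
/-- Under the empty star the observer reaches no relay, so the bad event is empty. [this work] -/
theorem starEvent_empty_inter_bad (A : Finset V) {o : V} (ho : o ∉ A) (j : ℕ) :
    starEvent o (↑(∅ : Finset V) : Set V) ∩ {ω : BondConfig V |
        1 ≤ (A.filter fun x => ω ∈ openConn o x).card ∧ (A.filter fun x => ω ∈ openConn o x).card ≤ j} = ∅ := by
  ext ω
  simp only [mem_inter_iff, mem_setOf_eq, mem_empty_iff_false, iff_false, not_and]
  intro hσ h1 _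
  have hB : ∀ u ∈ (∅ : Finset V), u ≠ o := by simp
  rw [filter_reachable_obs_eq A ho hB hσ] at h1
  have : (A.filter fun x => ∃ u ∈ (∅ : Finset V), ω ∈ openConnIn {o}ᶜ u x) = ∅ :=
    Finset.filter_false_of_mem fun x _ => by simp
  rw [this, Finset.card_empty] at h1
  exact Nat.not_succ_le_zero 0 h1

/-- **A star through a relay that is `H`-heavier than the witness satisfies pre-CIL on the star.**
For `o ∉ A`, a star `B ⊆ V ∖ {o}`, a relay `b ∈ B ∩ A` and a relay `c ∈ A` with
`μ(|{x ∈ A : b ↔ x off o}| ≤ j) ≤ μ(|{x ∈ A : c ↔ x off o}| ≤ j)` (`c` is `G ∖ {o}`-lighter than `b`):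
`μ(σ_B ∩ {1 ≤ N ≤ j}) ≤ μ(σ_B ∩ {o ↔ A} ∩ {N_c ≤ j})`.  Kozma–Nitzan's Lemma 5 for the cluster property
`|C ∩ A| > j`, with the star weight factored by independence.
[this work; cite: KozmaNitzan2024, Lemma 5 (p. 13), Lemma 3(ii) (pp. 6–7), §5.1 (p. 31)] -/
theorem relayStar_bad_le (w : Sym2 V → unitInterval) (A : Finset V) {o : V} (ho : o ∉ A) (j : ℕ)
    {B : Finset V} (hB : ∀ u ∈ B, u ≠ o) {b c : V} (hbB : b ∈ B) (hbA : b ∈ A) (hcA : c ∈ A)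
    (hcb : (prodBernoulli w).real {ω : BondConfig V | (A.filter fun x => ω ∈ openConnIn {o}ᶜ b x).card ≤ j} ≤
      (prodBernoulli w).real {ω : BondConfig V | (A.filter fun x => ω ∈ openConnIn {o}ᶜ c x).card ≤ j}) :
    (prodBernoulli w).real (starEvent o (↑B : Set V) ∩ {ω : BondConfig V |
        1 ≤ (A.filter fun x => ω ∈ openConn o x).card ∧ (A.filter fun x => ω ∈ openConn o x).card ≤ j}) ≤
      (prodBernoulli w).real (starEvent o (↑B : Set V) ∩ ((⋃ a ∈ A, (openConn o a : Set (BondConfig V))) ∩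
        {ω | (A.filter fun x => ω ∈ openConn c x).card ≤ j})) := by
  set μ := prodBernoulli w with hμ
  have hco : c ≠ o := fun h => ho (h ▸ hcA)
  have hbo : b ≠ o := hB b hbB
  set σ : Set (BondConfig V) := starEvent o (↑B : Set V) with hσdef
  set bad : Set (BondConfig V) := {ω | 1 ≤ (A.filter fun x => ω ∈ openConn o x).card ∧
    (A.filter fun x => ω ∈ openConn o x).card ≤ j} with hbad
  set X : Set (BondConfig V) := ⋃ a ∈ A, (openConn o a : Set (BondConfig V)) with hX
  set Gc : Set (BondConfig V) := {ω | (A.filter fun x => ω ∈ openConn c x).card ≤ j} with hGc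
  set Usm : Set (BondConfig V) := {ω | (A.filter fun x => ∃ u ∈ B, ω ∈ openConnIn {o}ᶜ u x).card ≤ j}
    with hUsm
  set Csm : Set (BondConfig V) := {ω | (A.filter fun x => ω ∈ openConnIn {o}ᶜ c x).card ≤ j} with hCsm
  set Conn : Set (BondConfig V) := {ω | ∃ u ∈ B, ω ∈ openConnIn {o}ᶜ c u} with hConn
  set NC : Set (BondConfig V) := {ω | ∀ u ∈ B, ω ∉ openConnIn {o}ᶜ c u} with hNC
  have hNCc : NC = Connᶜ := by ext ω; simp [hNC, hConn]
  -- `X` holds on the star (the pair `o b` is open)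
  have hXσ : σ ⊆ X := by
    intro ω hω
    have hob : s(o, b) ∈ ω := ((mem_starEvent_iff o (↑B) ω).1 hω b hbo).2 hbB
    exact mem_iUnion₂.2 ⟨b, hbA, ((openGraph_adj ω o b).2 ⟨hob, hbo.symm⟩).reachable⟩
  -- reading the relay counts on the star
  have incl1 : σ ∩ bad ⊆ Usm ∩ σ := by
    rintro ω ⟨hω, -, h2⟩
    refine ⟨?_, hω⟩
    simp only [hUsm, mem_setOf_eq]
    rwa [filter_reachable_obs_eq A ho hB hω] at h2
  have incl2 : (Usm ∩ Conn) ∩ σ ⊆ σ ∩ (X ∩ Gc) := by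
    rintro ω ⟨⟨hU, hC⟩, hω⟩
    refine ⟨hω, hXσ hω, ?_⟩
    simp only [hGc, mem_setOf_eq]
    rw [filter_reachable_eq_union A ho hB hω hco hC]
    exact hU
  have incl3 : (Csm ∩ NC) ∩ σ ⊆ σ ∩ (X ∩ Gc) := by
    rintro ω ⟨⟨hCs, hN⟩, hω⟩
    refine ⟨hω, hXσ hω, ?_⟩
    simp only [hGc, mem_setOf_eq]
    rw [filter_reachable_eq_cluster A ho hB hω hco hN]
    exact hCs
  -- the `H`-events are pull-backs along the restriction to `{o}ᶜ`, hence independent of the star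
  have hmeas : ∀ s : Set (BondConfig V), MeasurableSet s := fun _ => MeasurableSet.of_discrete
  have eUC : μ.real ((Usm ∩ Conn) ∩ σ) = μ.real σ * μ.real (Usm ∩ Conn) := by
    rw [Set.inter_comm (Usm ∩ Conn) σ, hUsm, hConn, usmall_eq_preimage A j hB, conn_eq_preimage hB hco,
      ← preimage_inter, hσdef, hμ, real_starEvent_inter_preimage]
  have eUN : μ.real ((Usm ∩ NC) ∩ σ) = μ.real σ * μ.real (Usm ∩ NC) := by
    rw [Set.inter_comm (Usm ∩ NC) σ, hUsm, hNC, usmall_eq_preimage A j hB, notConn_eq_preimage hB hco,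
      ← preimage_inter, hσdef, hμ, real_starEvent_inter_preimage]
  have eCN : μ.real ((Csm ∩ NC) ∩ σ) = μ.real σ * μ.real (Csm ∩ NC) := by
    rw [Set.inter_comm (Csm ∩ NC) σ, hCsm, hNC, small_eq_preimage A j hco, notConn_eq_preimage hB hco,
      ← preimage_inter, hσdef, hμ, real_starEvent_inter_preimage]
  -- Kozma–Nitzan's Lemma 5 (star row with `v = c`): `μ(Usm ∩ NC) ≤ μ(Csm ∩ NC)`
  have row : μ.real (Usm ∩ NC) ≤ μ.real (Csm ∩ NC) := by
    have key := starRow_transfer w A j hB hco hco le_rfl ⟨b, hbB, hcb⟩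
    have split : μ.real Csm = μ.real (Csm ∩ Conn) + μ.real (Csm ∩ NC) := by
      rw [hNCc, ← measureReal_inter_add_sdiff (μ := μ) (s := Csm) (hmeas Conn), Set.sdiff_eq]
    simp only [← hμ] at key
    linarith
  -- splitting `Usm ∩ σ` along `Conn` / `NC`
  have splitU : μ.real (Usm ∩ σ) = μ.real ((Usm ∩ Conn) ∩ σ) + μ.real ((Usm ∩ NC) ∩ σ) := by
    have := measureReal_inter_add_sdiff (μ := μ) (s := Usm ∩ σ) (hmeas Conn)
    rw [Set.sdiff_eq, ← hNCc] at this
    rw [← this]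
    congr 1
    · congr 1; ext ω; simp only [mem_inter_iff]; tauto
    · congr 1; ext ω; simp only [mem_inter_iff]; tauto
  -- the two good pieces are disjoint parts of `σ ∩ (X ∩ Gc)`
  have hdisj : Disjoint ((Usm ∩ Conn) ∩ σ) ((Csm ∩ NC) ∩ σ) := by
    refine Set.disjoint_left.2 fun ω h h' => ?_
    have h1 : ω ∈ Conn := h.1.2
    have h2 : ω ∈ NC := h'.1.2
    rw [hNCc] at h2
    exact h2 h1
  have hunion : μ.real ((Usm ∩ Conn) ∩ σ) + μ.real ((Csm ∩ NC) ∩ σ) ≤ μ.real (σ ∩ (X ∩ Gc)) := by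
    rw [← measureReal_union hdisj (hmeas _)]
    exact measureReal_mono (union_subset incl2 incl3) (measure_ne_top μ _)
  have hσ0 : 0 ≤ μ.real σ := measureReal_nonneg
  calc μ.real (σ ∩ bad) ≤ μ.real (Usm ∩ σ) := measureReal_mono incl1 (measure_ne_top μ _)
    _ = μ.real ((Usm ∩ Conn) ∩ σ) + μ.real ((Usm ∩ NC) ∩ σ) := splitU
    _ ≤ μ.real ((Usm ∩ Conn) ∩ σ) + μ.real ((Csm ∩ NC) ∩ σ) := by
        rw [eUN, eCN]; exact add_le_add le_rfl (mul_le_mul_of_nonneg_left row hσ0)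
    _ ≤ μ.real (σ ∩ (X ∩ Gc)) := hunion

/-- **The star recursion for the pre-FKG cumulative isolation inequality** (general observer, fixed witness).
Let `o ∉ A`, `c ∈ A`, `j : ℕ`.  Suppose (i) `c` is `G ∖ {o}`-lighter than every positive-weight relay neighbour of
`o`: `μ(|{x ∈ A : b ↔ x off o}| ≤ j) ≤ μ(|{x ∈ A : c ↔ x off o}| ≤ j)` for `b ∈ A`, `w s(o,b) ≠ 0`; and (ii) for
every nonempty set `B` of positive-weight NON-relay neighbours of `o`, the pre-CIL inequality holds on the star
`σ_B`: `μ(σ_B ∩ {1 ≤ N ≤ j}) ≤ μ(σ_B ∩ {o ↔ A} ∩ {N_c ≤ j})` (the pre-CIL inequality of the instance "`B` glued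
into one observer in `G ∖ {o}`").  Then `μ(1 ≤ N ≤ j) ≤ μ({o ↔ A} ∩ {N_c ≤ j})`.
[this work; cite: KozmaNitzan2024, Thm. 5 and Lemma 5 (pp. 13–14), §5.1 (p. 31)] -/
theorem preCIL_of_starRows (w : Sym2 V → unitInterval) (A : Finset V) (o c : V) (j : ℕ) (ho : o ∉ A)
    (hcA : c ∈ A)
    (hport : ∀ b ∈ A, w s(o, b) ≠ 0 →
      (prodBernoulli w).real {ω : BondConfig V | (A.filter fun x => ω ∈ openConnIn {o}ᶜ b x).card ≤ j} ≤
        (prodBernoulli w).real {ω : BondConfig V | (A.filter fun x => ω ∈ openConnIn {o}ᶜ c x).card ≤ j})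
    (hstein : ∀ B : Finset V, B.Nonempty → (∀ u ∈ B, u ≠ o) → (∀ u ∈ B, u ∉ A) → (∀ u ∈ B, w s(o, u) ≠ 0) →
      (prodBernoulli w).real (starEvent o (↑B : Set V) ∩ {ω : BondConfig V |
          1 ≤ (A.filter fun x => ω ∈ openConn o x).card ∧ (A.filter fun x => ω ∈ openConn o x).card ≤ j}) ≤
        (prodBernoulli w).real (starEvent o (↑B : Set V) ∩ ((⋃ a ∈ A, (openConn o a : Set (BondConfig V))) ∩
          {ω | (A.filter fun x => ω ∈ openConn c x).card ≤ j}))) :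
    (prodBernoulli w).real {ω : BondConfig V |
        1 ≤ (A.filter fun x => ω ∈ openConn o x).card ∧ (A.filter fun x => ω ∈ openConn o x).card ≤ j} ≤
      (prodBernoulli w).real ((⋃ a ∈ A, (openConn o a : Set (BondConfig V))) ∩
        {ω | (A.filter fun x => ω ∈ openConn c x).card ≤ j}) := by
  set μ := prodBernoulli w with hμ
  set bad : Set (BondConfig V) := {ω | 1 ≤ (A.filter fun x => ω ∈ openConn o x).card ∧
    (A.filter fun x => ω ∈ openConn o x).card ≤ j} with hbad
  set good : Set (BondConfig V) := (⋃ a ∈ A, (openConn o a : Set (BondConfig V))) ∩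
    {ω | (A.filter fun x => ω ∈ openConn c x).card ≤ j} with hgood
  -- all vertices other than `o` are admissible ports
  set P : Finset V := Finset.univ.erase o with hP
  have hoP : o ∉ P := by simp [hP]
  have hiso : ∀ u, u ≠ o → u ∉ P → w s(o, u) = 0 := fun u huo huP => by simp [hP, huo] at huP
  rw [real_eq_sum_inter_starEvent w P o hoP hiso bad, real_eq_sum_inter_starEvent w P o hoP hiso good]
  refine Finset.sum_le_sum fun B hBP => ?_
  have hB : ∀ u ∈ B, u ≠ o := fun u hu => by
    have := Finset.mem_powerset.1 hBP hu
    simpa [hP] using this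
  rw [Set.inter_comm bad, Set.inter_comm good]
  by_cases hnull : ∃ u ∈ B, w s(o, u) = 0
  · -- a null star
    obtain ⟨u, huB, hwu⟩ := hnull
    have h0 : μ.real (starEvent o (↑B : Set V)) = 0 := real_starEvent_eq_zero_of_weight w huB (hB u huB) hwu
    have : μ.real (starEvent o (↑B : Set V) ∩ bad) = 0 :=
      le_antisymm ((measureReal_mono Set.inter_subset_left (measure_ne_top μ _)).trans h0.le)
        measureReal_nonneg
    rw [this]; exact measureReal_nonneg
  push Not at hnull
  by_cases hrel : ∃ b ∈ B, b ∈ A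
  · -- a star through a relay: Kozma–Nitzan's Lemma 5
    obtain ⟨b, hbB, hbA⟩ := hrel
    exact relayStar_bad_le w A ho j hB hbB hbA hcA (hport b hbA (hnull b hbB))
  push Not at hrel
  by_cases hne : B.Nonempty
  · -- a star of Steiner vertices: the hypothesis (pre-CIL for the glued instance)
    exact hstein B hne hB hrel hnull
  · -- the empty star: the observer is isolated
    rw [Finset.not_nonempty_iff_eq_empty] at hne
    subst hne
    rw [hbad, starEvent_empty_inter_bad A ho j, measureReal_empty]
    exact measureReal_nonneg

/-- **pre-CIL for one-layer observers with an `H`-witness.**  If every positive-weight pair at `o` goes to a relay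
(`w s(o,u) = 0` for `u ∉ A`, `u ≠ o`) and `c ∈ A` is `G ∖ {o}`-lighter than every positive-weight relay neighbour of
`o`, then `μ(1 ≤ N ≤ j) ≤ μ({o ↔ A} ∩ {N_c ≤ j})` — the pre-FKG form of the one-layer cumulative isolation lemma
(Kozma–Nitzan's Theorem 8 for the property `|C ∩ A| > j`). [this work; cite: KozmaNitzan2024, Thm. 4 (p. 12), Thm. 8 (p. 32)] -/
theorem preCIL_oneLayer_Hwitness (w : Sym2 V → unitInterval) (A : Finset V) (o c : V) (j : ℕ) (ho : o ∉ A)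
    (hcA : c ∈ A) (hiso : ∀ u, u ≠ o → u ∉ A → w s(o, u) = 0)
    (hport : ∀ b ∈ A, w s(o, b) ≠ 0 →
      (prodBernoulli w).real {ω : BondConfig V | (A.filter fun x => ω ∈ openConnIn {o}ᶜ b x).card ≤ j} ≤
        (prodBernoulli w).real {ω : BondConfig V | (A.filter fun x => ω ∈ openConnIn {o}ᶜ c x).card ≤ j}) :
    (prodBernoulli w).real {ω : BondConfig V |
        1 ≤ (A.filter fun x => ω ∈ openConn o x).card ∧ (A.filter fun x => ω ∈ openConn o x).card ≤ j} ≤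
      (prodBernoulli w).real ((⋃ a ∈ A, (openConn o a : Set (BondConfig V))) ∩
        {ω | (A.filter fun x => ω ∈ openConn c x).card ≤ j}) := by
  refine preCIL_of_starRows w A o c j ho hcA hport fun B hne hB hrel hpos => ?_
  obtain ⟨u, huB⟩ := hne
  exact absurd (hiso u (hB u huB) (hrel u huB)) (hpos u huB)

/-- **CIL form of the star recursion.**  Under the hypotheses of `preCIL_of_starRows`,
`μ(1 ≤ N ≤ j) ≤ μ(N_c ≤ j)` (drop `{o ↔ A}`), the cumulative isolation inequality with witness `c` — the shape
of the hypothesis of `noHeavyLowerTail_of_stub_cumulativeIsolation` for this instance. [this work] -/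
theorem cumulativeIsolation_of_starRows (w : Sym2 V → unitInterval) (A : Finset V) (o c : V) (j : ℕ)
    (ho : o ∉ A) (hcA : c ∈ A)
    (hport : ∀ b ∈ A, w s(o, b) ≠ 0 →
      (prodBernoulli w).real {ω : BondConfig V | (A.filter fun x => ω ∈ openConnIn {o}ᶜ b x).card ≤ j} ≤
        (prodBernoulli w).real {ω : BondConfig V | (A.filter fun x => ω ∈ openConnIn {o}ᶜ c x).card ≤ j})
    (hstein : ∀ B : Finset V, B.Nonempty → (∀ u ∈ B, u ≠ o) → (∀ u ∈ B, u ∉ A) → (∀ u ∈ B, w s(o, u) ≠ 0) →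
      (prodBernoulli w).real (starEvent o (↑B : Set V) ∩ {ω : BondConfig V |
          1 ≤ (A.filter fun x => ω ∈ openConn o x).card ∧ (A.filter fun x => ω ∈ openConn o x).card ≤ j}) ≤
        (prodBernoulli w).real (starEvent o (↑B : Set V) ∩ ((⋃ a ∈ A, (openConn o a : Set (BondConfig V))) ∩
          {ω | (A.filter fun x => ω ∈ openConn c x).card ≤ j}))) :
    (prodBernoulli w).real {ω : BondConfig V |
        1 ≤ (A.filter fun x => ω ∈ openConn o x).card ∧ (A.filter fun x => ω ∈ openConn o x).card ≤ j} ≤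
      (prodBernoulli w).real {ω : BondConfig V | (A.filter fun x => ω ∈ openConn c x).card ≤ j} :=
  (preCIL_of_starRows w A o c j ho hcA hport hstein).trans
    (measureReal_mono Set.inter_subset_right (measure_ne_top _ _))

end PreCILStar

end Summit.CriticalPhenomena.PercolationContinuityZ3.Theorems

end
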